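import Mathlib
import HarnessLib
import Literature.Dynamics.Hamiltonian.KaloshinZhang2018.DominantHamiltonians

/-!
# Kaloshin–Zhang 2018 (Bull. SMF 146): Theorems 2.2, 2.3, 2.4 on dominant Hamiltonians, typed as SHAPES over the objects of `DominantHamiltonians`

CITATION HEADER (lean-in-tree rule 2026-08-18). Source: V. Kaloshin, K. Zhang, *Dynamics of the dominant
Hamiltonian*, Bull. Soc. Math. France **146** (2018) no. 3, 517–574, doi:10.24033/bsmf.2765 = bib key
`KaloshinZhang2018` — REFEREED, PUBLISHED. Read in the authors' arXiv version arXiv:1410.1844v2 (TeX source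
`dominant-arxiv-v2.tex`; every locator `l.NNN` below is a LINE of that file; the printed pagination is not held
by the cell that wrote this file, run/shared/lean/pub/pub-arnold, acquisition request acq-07781). Companion of
`Literature.Dynamics.Hamiltonian.KaloshinZhang2018.DominantHamiltonians`, which types the OBJECTS (resonance
lattices, `Ω^{m,d}_{κ,q}(𝓑ˢᵗ)`, the blocks `A, B, C̃`, `c̄`, the fields (Xs)/(Xˢᵗ_L), the rescaling `Φ_Σ`,
the shape of Theorem 2.1); here the CONCLUSIONS of the three perturbation theorems are typed.

WHAT IS REPRODUCED (verbatim, then the typed reading).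
* Theorem 2.2 (thm:resc-est, l.784–795): "Fix 𝓑ˢᵗ and κ > 1. Assume that q > 2. Then there exists a constant
  M = M(𝓑ˢᵗ, Q, κ, q, d−m) > 1, such that for (𝓑ʷᵏ, p, Uˢᵗ, 𝒰ʷᵏ) ∈ Ω^{m,d}_{κ,q}(𝓑ˢᵗ) and H^s =
  𝓗^s(𝓑ˢᵗ, 𝓑ʷᵏ, p, Uˢᵗ, 𝒰ʷᵏ), Hˢᵗ = 𝓗ˢᵗ(p, Uˢᵗ), such that the following hold. For the rescaling parameter
  σⱼ = |kⱼʷᵏ|^{−(q+1)/3}, uniformly on ℝᵐ × ℝ^{d−m} × ℝᵐ × ℝ^{d−m} we have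
  ‖Π_{(φˢᵗ,vˢᵗ)}(X̃ˢ − Xˢᵗ_L)‖_{C⁰} ≤ M 𝔐(𝓑ʷᵏ)^{−(q−1)}, ‖DX̃ˢ − DXˢᵗ_L‖_{C⁰} ≤ M 𝔐(𝓑ʷᵏ)^{−(q−2)/3}."
  → `Theorem22Shape`.
* Theorem 2.3 (thm:nhic-persist, l.862–886): "Consider a strong lattice 𝓑ˢᵗ, a strong potential Uˢᵗ ∈ C²(𝕋ᵐ),
  κ > 0, a > 0, and q > 2. Assume that the Euler–Lagrange vector field Xˢᵗ_Lag of Hˢᵗ = 𝓗ˢᵗ(𝓑ˢᵗ, p₀, Uˢᵗ)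
  admits a 2l-dimensional cylinder Λˢᵗ_a = χˢᵗ(𝕋ˡ × Bˡ_{1+a}) that is normally hyperbolic (fully) invariant,
  with the parameters 0 < α < β² < 1. Then there exists an open set V ⊃ Λ₀ˢᵗ such that for any δ > 0, there
  exists M > 0, such that for any (𝓑ˢᵗ, 𝓑ʷᵏ, p₀, Uˢᵗ) ∈ Ω_{m,d}^{κ,q}(𝓑ˢᵗ), Hˢ = 𝓗ˢ(𝓑ˢᵗ, 𝓑ʷᵏ, p₀, Uˢᵗ), the
  following hold. There exists a C¹ embedding ηˢ = (ηˢᵗ, ηʷᵏ) : (𝕋ˡ × Bˡ) × (𝕋^{d−m} × ℝ^{d−m}) → (𝕋ᵐ × Bᵐ) ×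
  (𝕋^{d−m} × ℝ^{d−m}), such that Λˢ = ηˢ((𝕋ˡ × Bˡ) × (𝕋^{d−m} × ℝ^{d−m})) is a 2(l+d−m)-dimensional NHWIC
  under Xˢ_Lag. Moreover, we have ‖ηˢᵗ − χˢᵗ‖_{C⁰} < δ, and any Xˢ_Lag-invariant set contained in
  V × (𝕋^{d−m} × ℝ^{d−m}) is contained in Λˢ." → `Theorem23Shape`, WITH the hypothesis `M ≤ 𝔐(𝓑ʷᵏ)` that the
  printed sentence omits (cell DIVERGENCE D9: "for any δ > 0, there exists M > 0, such that for any … ∈ Ω" never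
  uses `M`; the evidently intended reading — l.857–860 "as 𝔐(𝓑ʷᵏ) → ∞", Main Theorem item 1 "for sufficiently
  large M(Λ|Λˢᵗ)" — is the one typed, and the docstring of `Theorem23Shape` says so).
* Theorem 2.4 (thm:semi-cont, l.975–1005): "Fix 𝓑ˢᵗ and κ > 1. Assume that q > 2(d−m). For p₀ ∈ ℝⁿ, U₀ˢᵗ ∈
  C²(𝕋ᵐ) and c̄ ∈ ℝᵐ, we consider a sequence (𝓑ᵢʷᵏ, pᵢ, Uᵢˢᵗ, 𝒰ᵢʷᵏ) ∈ Ω^{m,d}_{κ,q}(𝓑ˢᵗ), cᵢ = (cᵢˢᵗ, cᵢʷᵏ) ∈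
  ℝᵐ × ℝ^{d−m}, and let uᵢ be a weak KAM solution of L_{𝓗ˢ(𝓑ˢᵗ,𝓑ᵢʷᵏ,pᵢ,Uᵢˢᵗ,𝒰ᵢʷᵏ)} − cᵢ·v. Denote Kᵢ =
  K_{pᵢ,𝓑ˢᵗ,𝓑ᵢʷᵏ}, and Aᵢ = ∂²_{IˢᵗIˢᵗ}Kᵢ, Bᵢ = ∂²_{IˢᵗIʷᵏ}Kᵢ, Cᵢ = ∂²_{IʷᵏIʷᵏ}Kᵢ. Assume: • 𝔐(Bᵢʷᵏ) → ∞,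
  pᵢ → p₀, Uᵢˢᵗ → U₀ˢᵗ. • cᵢˢᵗ + Aᵢ⁻¹Bᵢcᵢʷᵏ → c̄. Then: 1. The sequence {uᵢ} is equi-continuous. In particular,
  the sequence {uᵢ(·) − uᵢ(0)} is pre-compact in the C⁰ topology. 2. Let u be any accumulation point of the
  sequence uᵢ(·) − uᵢ(0). Then there exists uˢᵗ : 𝕋ᵐ → ℝ such that u(φˢᵗ, φʷᵏ) = uˢᵗ(φˢᵗ), i.e, u is
  independent of φʷᵏ. 3. uˢᵗ is a weak KAM solution of L_{𝓗ˢᵗ(p₀,U₀ˢᵗ)} − c̄·vˢᵗ." → `Theorem24Shape`; the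
  hypothesis `cᵢˢᵗ + Aᵢ⁻¹Bᵢcᵢʷᵏ → c̄` is the CONCRETE `BlockForm.cbar Aᵢ Bᵢ cᵢˢᵗ cᵢʷᵏ → c̄` with `Aᵢ, Bᵢ` the
  blocks `hessK`, `blockB` of the companion file.
* The authors' threshold bookkeeping (Remark, l.1008–1012): "Theorem 2.1 implies that by choosing a good basis,
  we can express a slow system as a dominant system with parameters κ, q, where q = r − n − 2(d−m) − 4. For
  Theorem 2.2 we need q > 2, and for Theorem 2.4 we need q > 2(d−m). Therefore for application to nearly
  integrable systems, we need r > n + 4(d−m) + 4 as stated in our main result." → `threshold_main_iff`,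
  `threshold_resc_of_main` (arithmetic, proved).

WHAT IS SCHEMATIC (deliberately; each choice is a row of the cell's DIVERGENCE.md, L13). As in
`KaloshinZhang2020.TheoremShapes`, no Hamiltonian flow, no `C²(𝕋ᵈ)` function space and no weak KAM theory is
built: a `DominantData n m w Tup USt` indexes the tuples `(𝓑ʷᵏ, p, Uˢᵗ, 𝒰ʷᵏ) ∈ Ω^{m,d}(𝓑ˢᵗ)` (l.636–650) by an
abstract type `Tup`, records `Q₀ = ∂²H₀` (l.630), the companion file's `OmegaPoint` (`𝓑ʷᵏ`, `p₀`, the table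
`‖Uⱼʷᵏ‖_{C²}`), the strong potential in an abstract topological space `USt` (for "`Uᵢˢᵗ → U₀ˢᵗ`"), and the
GRADIENTS of the potentials as functions on the universal cover, from which the fields (Xs), (Xˢᵗ_L) of the
companion file are assembled with the CONCRETE blocks `A = hessK Q 𝓑ˢᵗ`, `B = blockB Q 𝓑ˢᵗ 𝓑ʷᵏ`,
`C̃ = schurC A B C`; the link between the recorded norms `‖Uⱼʷᵏ‖_{C²}` and the gradient functions belongs to the
interpretation. Normal hyperbolicity, (weak) invariance (definitions l.806–845) and "weak KAM solution" (§2.6,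
§6) are abstract predicates supplied as data (`CylinderData`, `WeakKAMData`). Norm conventions fixed here where
the text leaves them implicit: the `C⁰` norms are suprema over the cover `ℝᵐ × ℝᵐ × ℝʷ × ℝʷ` of the max-norm of
the components (`PhaseSp`, Pi/product sup norms), `‖DX̃ˢ − DXˢᵗ_L‖_{C⁰}` is the pointwise operator norm of the
difference of Fréchet derivatives (differentiability being part of the predicate `DerivLe`), `Bˡ` is the closed
Euclidean unit ball, "`‖ηˢᵗ − χˢᵗ‖_{C⁰} < δ`" on the non-compact domain is "`sup ≤ δ'` for some `δ' < δ`", and an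
"accumulation point in the C⁰ topology" of functions on `𝕋ᵈ` is a uniform limit of a subsequence of their lifts.
Consequently every shape is a PREDICATE on schematic data; the published theorems assert these predicates of
the data arising from genuine `C²`/`Cʳ` Hamiltonians, and NO closed proposition "∀ data, …" is stated (over
junk data it would be false, and meaningless as a named fact) — the cell's rule L11.

WHAT IS PROVED (kernel-checked remarks; nothing is postulated): `𝔐(𝓑ʷᵏ)` as a natural number agrees with the `ℕ∞`
version of the companion file (`minWeak_eq_coe_minWeakN`); the strong projection of `X̃ˢ − Xˢᵗ_L` is
`(0, A ∂_{φˢᵗ}Uʷᵏ + B ∂_{φʷᵏ}Uʷᵏ)` evaluated at `Σ⁻¹φʷᵏ` (`strongProj_rescaledXs_sub`), so that the FIRST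
estimate of Theorem 2.2 is insensitive to the rescaling (`strongProjLe_rescaled_iff`: the rescaling `Φ_Σ`
matters only for the derivative estimate — eq. (xs-diff)/(dxs-diff) l.1284–1305 and Lemma lem:matrix-bound
l.1318–1331 of the proof in §4); the threshold arithmetic of the Remark l.1008–1012.
-/

noncomputable section

open Matrix Finset Filter Set Function
open scoped Topology

namespace Literature.Dynamics.Hamiltonian.KaloshinZhang2018

variable {n m w : ℕ}

/-! ### The cover `ℝᵐ × ℝᵐ × ℝʷ × ℝʷ` as a normed space; `C⁰` and `C¹` closeness of half-Lagrangian fields -/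

/-- The universal cover `ℝᵐ × ℝᵐ × ℝʷ × ℝʷ ∋ ((φˢᵗ, vˢᵗ), (φʷᵏ, Iʷᵏ))` of the phase space in the
half-Lagrangian coordinates (l.735–738), with the product/Pi sup norms of Mathlib ("uniformly on
ℝᵐ × ℝ^{d−m} × ℝᵐ × ℝ^{d−m}", l.788). [cite: KaloshinZhang2018, §2.3 l.735–738, Theorem 2.2 l.788] -/
abbrev PhaseSp (m w : ℕ) : Type := ((Fin m → ℝ) × (Fin m → ℝ)) × ((Fin w → ℝ) × (Fin w → ℝ))

namespace HalfLag

/-- Coordinates of a half-Lagrangian point. [folklore] -/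
def toPhase (z : HalfLag m w) : PhaseSp m w := ((z.φst, z.vst), (z.φwk, z.Iwk))

/-- The half-Lagrangian point with given coordinates. [folklore] -/
def ofPhase (x : PhaseSp m w) : HalfLag m w := ⟨x.1.1, x.1.2, x.2.1, x.2.2⟩

/-- coordinates of the point with given coordinates. [folklore] -/
@[simp] theorem toPhase_ofPhase (x : PhaseSp m w) : (ofPhase x).toPhase = x := rfl

/-- the point with the coordinates of `z` is `z`. [folklore] -/
@[simp] theorem ofPhase_toPhase (z : HalfLag m w) : ofPhase z.toPhase = z := rfl

/-- `HalfLag m w ≃ ℝᵐ × ℝᵐ × ℝʷ × ℝʷ`. [folklore] -/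
def equivPhase : HalfLag m w ≃ PhaseSp m w := ⟨toPhase, ofPhase, ofPhase_toPhase, toPhase_ofPhase⟩

end HalfLag

/-- A vector field on `HalfLag m w` read in coordinates, as a self-map of the normed space `PhaseSp m w`. [folklore] -/
def liftField (X : HalfLag m w → HalfLag m w) : PhaseSp m w → PhaseSp m w := fun x => (X (HalfLag.ofPhase x)).toPhase

/-- **`‖Π_{(φˢᵗ,vˢᵗ)}(X − Y)‖_{C⁰} ≤ b`** on the cover: at every point the strong components of `X − Y` have
max-norm at most `b` (Theorem 2.2, first estimate, l.789–790). [cite: KaloshinZhang2018, Theorem 2.2 l.789–790] -/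
def StrongProjLe (X Y : HalfLag m w → HalfLag m w) (b : ℝ) : Prop :=
  ∀ x : PhaseSp m w, ‖(liftField X x).1 - (liftField Y x).1‖ ≤ b

/-- **`‖DX − DY‖_{C⁰} ≤ b`** on the cover: both fields are differentiable and their Fréchet derivatives differ by
at most `b` in operator norm at every point (Theorem 2.2, second estimate, l.792–793; differentiability is part of
the predicate so that the junk value `fderiv = 0` cannot satisfy it vacuously). [cite: KaloshinZhang2018, Theorem 2.2 l.792–793] -/
def DerivLe (X Y : HalfLag m w → HalfLag m w) (b : ℝ) : Prop :=
  Differentiable ℝ (liftField X) ∧ Differentiable ℝ (liftField Y) ∧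
    ∀ x : PhaseSp m w, ‖fderiv ℝ (liftField X) x - fderiv ℝ (liftField Y) x‖ ≤ b

/-- The strong projection of `Xˢ − Xˢᵗ_L` in coordinates: `(0, A ∂_{φˢᵗ}Uʷᵏ + B ∂_{φʷᵏ}Uʷᵏ)` (l.729–731;
`FieldData.strongProjection_sub` of the companion file). [cite: KaloshinZhang2018, §2.3 l.729–731] -/
theorem strongProj_Xs_sub (𝔇 : FieldData m w) (x : PhaseSp m w) :
    (liftField 𝔇.Xs x).1 - (liftField 𝔇.XstL x).1 =
      (0, 𝔇.A *ᵥ 𝔇.gradStUwk x.1.1 x.2.1 + 𝔇.B *ᵥ 𝔇.gradWkUwk x.1.1 x.2.1) := by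
  refine Prod.ext ?_ ?_
  · simp [liftField, HalfLag.toPhase, HalfLag.ofPhase, FieldData.Xs, FieldData.XstL]
  · simp only [liftField, HalfLag.toPhase, HalfLag.ofPhase, FieldData.Xs, FieldData.XstL, Prod.snd_sub,
      Matrix.mulVec_add]
    abel

/-- The strong projection of the RESCALED field minus `Xˢᵗ_L`: the same expression evaluated at `Σ⁻¹φ̃ʷᵏ` — the
rescaling `Φ_Σ` (l.771–781) does not act on the strong components. This is the first two lines of eq. (xs-diff),
§4 l.1284–1292: "X̃ˢ − Xˢᵗ_L = [0; (A∂_{φˢᵗ}Uʷᵏ + B∂_{φʷᵏ}Uʷᵏ)(φˢᵗ, Σ⁻¹φ̃ʷᵏ); ΣBᵀA⁻¹vˢᵗ − ΣC̃ΣĨʷᵏ;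
Σ⁻¹∂_{φʷᵏ}Uʷᵏ(φˢᵗ, Σ⁻¹φ̃ʷᵏ)]" (whose last two lines also confirm the conjugation `Φ_Σ⁻¹ ∘ Xˢ ∘ Φ_Σ` typed as
`HalfLag.rescaledField`; l.1336 calls the strong projection "the first and third line", a residue of the variable
order `(φˢᵗ, φʷᵏ, vˢᵗ, Iʷᵏ)` of the commented-out l.1278–1281). [cite: KaloshinZhang2018, §4 eq. (xs-diff) l.1284–1292, §2.3 l.771–781] -/
theorem strongProj_rescaledXs_sub (σ : Fin w → ℝ) (𝔇 : FieldData m w) (x : PhaseSp m w) :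
    (liftField (HalfLag.rescaledField σ 𝔇.Xs) x).1 - (liftField 𝔇.XstL x).1 =
      (0, 𝔇.A *ᵥ 𝔇.gradStUwk x.1.1 (fun j => (σ j)⁻¹ * x.2.1 j) +
        𝔇.B *ᵥ 𝔇.gradWkUwk x.1.1 (fun j => (σ j)⁻¹ * x.2.1 j)) := by
  refine Prod.ext ?_ ?_
  · simp [liftField, HalfLag.toPhase, HalfLag.ofPhase, HalfLag.rescaledField, HalfLag.rescale,
      HalfLag.invRescale, FieldData.Xs, FieldData.XstL]
  · simp only [liftField, HalfLag.toPhase, HalfLag.ofPhase, HalfLag.rescaledField, HalfLag.rescale,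
      HalfLag.invRescale, FieldData.Xs, FieldData.XstL, Prod.snd_sub, Matrix.mulVec_add]
    abel

/-- **The first estimate of Theorem 2.2 is insensitive to the rescaling**: for `σⱼ ≠ 0`,
`‖Π_{(φˢᵗ,vˢᵗ)}(X̃ˢ − Xˢᵗ_L)‖_{C⁰} ≤ b ↔ ‖Π_{(φˢᵗ,vˢᵗ)}(Xˢ − Xˢᵗ_L)‖_{C⁰} ≤ b` (both are suprema of the same
function of `(φˢᵗ, φʷᵏ)` over the cover; cf. l.730–731 "we only need to show ‖B∂_{φʷᵏ}U‖ → 0" and §4).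
[cite: KaloshinZhang2018, §2.3 l.730–731, Theorem 2.2 l.789–790] -/
theorem strongProjLe_rescaled_iff {σ : Fin w → ℝ} (hσ : ∀ j, σ j ≠ 0) (𝔇 : FieldData m w) (b : ℝ) :
    StrongProjLe (HalfLag.rescaledField σ 𝔇.Xs) 𝔇.XstL b ↔ StrongProjLe 𝔇.Xs 𝔇.XstL b := by
  constructor
  · intro h x
    have hx := h (x.1, (fun j => σ j * x.2.1 j, x.2.2))
    rw [strongProj_rescaledXs_sub] at hx
    rw [strongProj_Xs_sub]
    have hφ : (fun j => (σ j)⁻¹ * (σ j * x.2.1 j)) = x.2.1 := by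
      funext j
      rw [inv_mul_cancel_left₀ (hσ j)]
    simpa [hφ] using hx
  · intro h x
    rw [strongProj_rescaledXs_sub]
    have hx := h (x.1, (fun j => (σ j)⁻¹ * x.2.1 j, x.2.2))
    rw [strongProj_Xs_sub] at hx
    simpa using hx

/-! ### `𝔐(𝓑ʷᵏ)` as a number and the rescaling exponents of Theorem 2.2 -/

namespace OmegaPoint

/-- `𝔐(𝓑ʷᵏ) = min_{1 ≤ j ≤ d−m} |kⱼʷᵏ|` as a natural number (l.664–665; `= 0` by convention when `w = 0`, a
case the source excludes by `m < d`). [cite: KaloshinZhang2018, §2.2 l.664–665] -/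
def minWeakN (ω : OmegaPoint n m w) : ℕ := ⨅ j : Fin w, supNorm (ω.𝓑wk j)

/-- `𝔐(𝓑ʷᵏ) ≤ |kⱼʷᵏ|`. [cite: KaloshinZhang2018, §2.2 l.664–665] -/
theorem minWeakN_le (ω : OmegaPoint n m w) (j : Fin w) : ω.minWeakN ≤ supNorm (ω.𝓑wk j) :=
  ciInf_le' _ j

/-- The minimum is attained (`w ≥ 1`). [folklore] -/
theorem exists_minWeakN_eq [Nonempty (Fin w)] (ω : OmegaPoint n m w) : ∃ j, ω.minWeakN = supNorm (ω.𝓑wk j) := by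
  obtain ⟨j, hj⟩ := (Set.range_nonempty fun j : Fin w => supNorm (ω.𝓑wk j)).csInf_mem (Set.finite_range _)
  exact ⟨j, hj.symm⟩

/-- Agreement with the `ℕ∞`-valued `minWeak` of the companion file (`w ≥ 1`). [folklore] -/
theorem minWeak_eq_coe_minWeakN [Nonempty (Fin w)] (ω : OmegaPoint n m w) : ω.minWeak = (ω.minWeakN : ℕ∞) := by
  refine le_antisymm ?_ (le_iInf fun j => ?_)
  · obtain ⟨j, hj⟩ := ω.exists_minWeakN_eq
    rw [hj]
    exact iInf_le _ j
  · exact_mod_cast ω.minWeakN_le j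

/-- In `Ω^{m,d}_{κ,q}(𝓑ˢᵗ)`: `‖Uⱼʷᵏ‖ ≤ κ 𝔐(𝓑ʷᵏ)^{−q}` (l.665–667), the `minWeakN` form of
`InOmega.norm_le_of_minWeak`. [cite: KaloshinZhang2018, §2.2 l.665–667] -/
theorem InOmega.norm_le_of_minWeakN {κ q : ℝ} {ω : OmegaPoint n m w} (h : ω.InOmega κ q) (hκ : 0 ≤ κ)
    (hq : 0 ≤ q) (hM : 0 < ω.minWeakN) (j : Fin w) : ω.normUwk j ≤ κ * (ω.minWeakN : ℝ) ^ (-q) :=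
  h.norm_le_of_minWeak hκ hq (by exact_mod_cast hM) (fun j => by exact_mod_cast ω.minWeakN_le j) j

/-- The rescaling parameters of Theorem 2.2: `σⱼ = |kⱼʷᵏ|^{−(q+1)/3}` (l.787). [cite: KaloshinZhang2018, Theorem 2.2 l.787] -/
def rescSigma (q : ℝ) (ω : OmegaPoint n m w) : Fin w → ℝ := fun j => ((supNorm (ω.𝓑wk j) : ℕ) : ℝ) ^ (-(q + 1) / 3)

/-- `σⱼ > 0` as soon as `kⱼʷᵏ ≠ 0` (a basis vector). [folklore] -/
theorem rescSigma_pos (q : ℝ) (ω : OmegaPoint n m w) {j : Fin w} (hj : 0 < supNorm (ω.𝓑wk j)) :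
    0 < rescSigma q ω j :=
  Real.rpow_pos_of_pos (by exact_mod_cast hj) _

end OmegaPoint

/-! ### The schematic family `𝓗ˢ : Ω^{m,d}(𝓑ˢᵗ) → C²(𝕋ᵈ × ℝᵈ)` -/

/-- SCHEMATIC datum for the space `Ω^{m,d}(𝓑ˢᵗ)` of tuples `(𝓑ʷᵏ, p₀, Uˢᵗ, 𝒰ʷᵏ)` with `𝓑ˢᵗ` fixed and the map
`𝓗ˢ(𝓑ˢᵗ, 𝓑ʷᵏ, p₀, Uˢᵗ, 𝒰ʷᵏ) = K_{p₀,𝓑ˢᵗ,𝓑ʷᵏ}(I) − Uˢᵗ(φ₁, ⋯, φ_m) − Σⱼ Uⱼʷᵏ(φ₁, ⋯, φ_{j+m})` (l.628–650): the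
tuples are indexed by an abstract type `Tup`; of each we record the companion file's `OmegaPoint` (`𝓑ʷᵏ`, `p₀`,
the norms `‖Uⱼʷᵏ‖_{C²}`), the strong potential as a point of an abstract space `USt` (standing for `C²(𝕋ᵐ)`),
and the gradients of the potentials lifted to the cover; `Q₀ = ∂²H₀ : ℝⁿ → Sym(n)` with `D⁻¹ ≤ Q₀ ≤ D` is item 1
of l.630. Nothing here asserts that the gradients come from potentials with the recorded norms — that is the
interpretation. [cite: KaloshinZhang2018, §2.2 l.628–650] -/
structure DominantData (n m w : ℕ) (Tup USt : Type) where
  /-- the fixed strong basis `𝓑ˢᵗ = [k₁ˢᵗ, ⋯, k_mˢᵗ]` (l.631) -/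
  𝓑st : Fin m → IntVec n
  /-- `Q₀ = ∂²H₀ : ℝⁿ → Sym(n)` (l.630) -/
  Q₀ : (Fin n → ℝ) → Matrix (Fin n) (Fin n) ℝ
  /-- `(𝓑ʷᵏ, p₀, (‖Uⱼʷᵏ‖_{C²})ⱼ)` of the tuple -/
  pt : Tup → OmegaPoint n m w
  /-- the strong potential `Uˢᵗ ∈ C²(𝕋ᵐ)` of the tuple -/
  ust : Tup → USt
  /-- `Uˢᵗ ↦ ∂_{φˢᵗ}Uˢᵗ`, lifted to `ℝᵐ` -/
  gradOf : USt → (Fin m → ℝ) → (Fin m → ℝ)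
  /-- `∂_{φˢᵗ}Uʷᵏ(φˢᵗ, φʷᵏ)`, `Uʷᵏ = Σⱼ Uⱼʷᵏ` (l.549–557), lifted to `ℝᵐ × ℝʷ` -/
  gradStUwk : Tup → (Fin m → ℝ) → (Fin w → ℝ) → (Fin m → ℝ)
  /-- `∂_{φʷᵏ}Uʷᵏ(φˢᵗ, φʷᵏ)` -/
  gradWkUwk : Tup → (Fin m → ℝ) → (Fin w → ℝ) → (Fin w → ℝ)

namespace DominantData

variable {Tup USt : Type} (𝔖 : DominantData n m w Tup USt)

/-- `Q₀(p₀)` of the tuple. [cite: KaloshinZhang2018, §2.2 l.630] -/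
def hess (t : Tup) : Matrix (Fin n) (Fin n) ℝ := 𝔖.Q₀ (𝔖.pt t).p₀

/-- `A = ∂²_{IˢᵗIˢᵗ}K_{p₀,𝓑ˢᵗ,𝓑ʷᵏ}` (eq. (ABC) l.701–712; Theorem 2.4 `Aᵢ`, l.991–993). [cite: KaloshinZhang2018, §2.3 l.701–712] -/
def blkA (t : Tup) : Matrix (Fin m) (Fin m) ℝ := hessK (𝔖.hess t) 𝔖.𝓑st

/-- `B = ∂²_{IˢᵗIʷᵏ}K_{p₀,𝓑ˢᵗ,𝓑ʷᵏ}` (Theorem 2.4 `Bᵢ`). [cite: KaloshinZhang2018, §2.3 l.701–712] -/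
def blkB (t : Tup) : Matrix (Fin m) (Fin w) ℝ := blockB (𝔖.hess t) 𝔖.𝓑st (𝔖.pt t).𝓑wk

/-- `C = ∂²_{IʷᵏIʷᵏ}K_{p₀,𝓑ˢᵗ,𝓑ʷᵏ}` (Theorem 2.4 `Cᵢ`). [cite: KaloshinZhang2018, §2.3 l.701–712] -/
def blkC (t : Tup) : Matrix (Fin w) (Fin w) ℝ := hessK (𝔖.hess t) (𝔖.pt t).𝓑wk

/-- The field data of `Hˢ = 𝓗ˢ(t)` and `Hˢᵗ = 𝓗ˢᵗ(p₀(t), Uˢᵗ(t))` (l.785–786): the concrete blocks `A, B`,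
`C̃ = C − BᵀA⁻¹B`, and the potential gradients of the tuple. [cite: KaloshinZhang2018, §2.3 l.700–770] -/
def field (t : Tup) : FieldData m w where
  A := 𝔖.blkA t
  B := 𝔖.blkB t
  Ct := BlockForm.schurC (𝔖.blkA t) (𝔖.blkB t) (𝔖.blkC t)
  gradUst := 𝔖.gradOf (𝔖.ust t)
  gradStUwk := 𝔖.gradStUwk t
  gradWkUwk := 𝔖.gradWkUwk t

/-- `X̃ˢ` of Theorem 2.2: the field (Xs) of the tuple conjugated by `Φ_Σ` with `σⱼ = |kⱼʷᵏ|^{−(q+1)/3}`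
(l.776–781, l.787). [cite: KaloshinZhang2018, Theorem 2.2 l.787, eq. (rescaling) l.776–781] -/
def rescaledXs (q : ℝ) (t : Tup) : HalfLag m w → HalfLag m w :=
  HalfLag.rescaledField ((𝔖.pt t).rescSigma q) (𝔖.field t).Xs

end DominantData

/-! ### Theorem 2.2 (rescaling estimates) as a shape -/

/-- **Shape of Theorem 2.2** (thm:resc-est, l.784–795) for fixed `𝓑ˢᵗ`, `κ > 1`, `q > 2`: "there exists a
constant M = M(𝓑ˢᵗ, Q, κ, q, d−m) > 1, such that for (𝓑ʷᵏ, p, Uˢᵗ, 𝒰ʷᵏ) ∈ Ω^{m,d}_{κ,q}(𝓑ˢᵗ) … for the rescaling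
parameter σⱼ = |kⱼʷᵏ|^{−(q+1)/3}, uniformly on ℝᵐ × ℝ^{d−m} × ℝᵐ × ℝ^{d−m} we have ‖Π_{(φˢᵗ,vˢᵗ)}(X̃ˢ − Xˢᵗ_L)‖_{C⁰}
≤ M 𝔐(𝓑ʷᵏ)^{−(q−1)}, ‖DX̃ˢ − DXˢᵗ_L‖_{C⁰} ≤ M 𝔐(𝓑ʷᵏ)^{−(q−2)/3}." A PREDICATE on the schematic family `𝔖`; the
theorem asserts it of the families coming from `C²` data (not built here). [cite: KaloshinZhang2018, Theorem 2.2 l.784–795] -/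
def Theorem22Shape {Tup USt : Type} (κ q : ℝ) (𝔖 : DominantData n m w Tup USt) : Prop :=
  ∃ M : ℝ, 1 < M ∧ ∀ t : Tup, (𝔖.pt t).InOmega κ q →
    StrongProjLe (𝔖.rescaledXs q t) (𝔖.field t).XstL (M * ((𝔖.pt t).minWeakN : ℝ) ^ (-(q - 1))) ∧
      DerivLe (𝔖.rescaledXs q t) (𝔖.field t).XstL (M * ((𝔖.pt t).minWeakN : ℝ) ^ (-(q - 2) / 3))

/-- By `strongProjLe_rescaled_iff`, the first clause of `Theorem22Shape` may be checked on the unrescaled field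
whenever the weak vectors are non-zero. [cite: KaloshinZhang2018, Theorem 2.2 l.789–790] -/
theorem Theorem22Shape.strongProj_unrescaled {Tup USt : Type} {κ q : ℝ} {𝔖 : DominantData n m w Tup USt}
    (h : Theorem22Shape κ q 𝔖) :
    ∃ M : ℝ, 1 < M ∧ ∀ t : Tup, (𝔖.pt t).InOmega κ q → (∀ j, 0 < supNorm ((𝔖.pt t).𝓑wk j)) →
      StrongProjLe (𝔖.field t).Xs (𝔖.field t).XstL (M * ((𝔖.pt t).minWeakN : ℝ) ^ (-(q - 1))) := by
  obtain ⟨M, hM, hall⟩ := h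
  refine ⟨M, hM, fun t ht hpos => ?_⟩
  have hσ : ∀ j, (𝔖.pt t).rescSigma q j ≠ 0 := fun j => ((𝔖.pt t).rescSigma_pos q (hpos j)).ne'
  exact (strongProjLe_rescaled_iff hσ (𝔖.field t) _).1 (hall t ht).1

/-! ### Theorem 2.3 (persistence of the strong NHIC) as a shape -/

/-- SCHEMATIC dynamics predicates for Theorem 2.3: the strong cylinder `χˢᵗ : 𝕋ˡ × Bˡ_{1+a} → 𝕋ᵐ × Bᵐ` lifted to
covers (angles in `ℝˡ`, actions in the Euclidean `ℝˡ`; values in the strong coordinates), the hypothesis "`χˢᵗ` is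
a normally hyperbolic (fully) invariant cylinder for `Xˢᵗ_Lag` of `𝓗ˢᵗ(𝓑ˢᵗ, p₀, Uˢᵗ)` with `0 < α < β² < 1`"
(definitions l.806–845), and the predicates "NHWIC under `Xˢ_Lag` of the tuple" / "`Xˢ_Lag`-invariant" on
subsets of the cover — none of them constructed here. [cite: KaloshinZhang2018, §2.5 l.806–861] -/
structure CylinderData (n m w l : ℕ) (Tup USt : Type) where
  /-- the strong cylinder map `χˢᵗ`, lifted -/
  χst : (Fin l → ℝ) × EuclideanSpace ℝ (Fin l) → (Fin m → ℝ) × (Fin m → ℝ)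
  /-- hypothesis of Theorem 2.3 on the strong system `𝓗ˢᵗ(𝓑ˢᵗ, p₀, Uˢᵗ)`: `χˢᵗ(𝕋ˡ × Bˡ_{1+a})` is a normally
  hyperbolic (fully) invariant `2l`-cylinder of `Xˢᵗ_Lag` with parameters `0 < α < β² < 1` (l.863–866) -/
  StrongNHIC : (Fin n → ℝ) → USt → Prop
  /-- "`S` is a `2(l + d − m)`-dimensional NHWIC under `Xˢ_Lag` of the tuple" (l.817–838, l.877–878) -/
  IsNHWIC : Tup → Set (PhaseSp m w) → Prop
  /-- "`S` is an `Xˢ_Lag`-invariant set" for the tuple (l.883) -/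
  IsInvariant : Tup → Set (PhaseSp m w) → Prop

/-- `𝕋ˡ × Bˡ_R` on the cover: angles free, actions in the closed Euclidean ball of radius `R` (l.806–809).
[cite: KaloshinZhang2018, §2.5 l.806–809] -/
def cylDom (l : ℕ) (R : ℝ) : Set ((Fin l → ℝ) × EuclideanSpace ℝ (Fin l)) :=
  univ ×ˢ Metric.closedBall 0 R

/-- **Shape of Theorem 2.3** (thm:nhic-persist, l.862–886) for fixed `𝓑ˢᵗ`, `κ > 0`, `a > 0`, `q > 2` and a fixed
strong system `(p₀, Uˢᵗ)` satisfying `StrongNHIC`: "there exists an open set V ⊃ Λ₀ˢᵗ such that for any δ > 0,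
there exists M > 0, such that for any (𝓑ˢᵗ, 𝓑ʷᵏ, p₀, Uˢᵗ) ∈ Ω_{m,d}^{κ,q}(𝓑ˢᵗ) [READ: every tuple of
Ω^{m,d}_{κ,q}(𝓑ˢᵗ) with this `p₀`, `Uˢᵗ` AND `𝔐(𝓑ʷᵏ) ≥ M` — the printed sentence never uses `M`; cell DIVERGENCE
D9; cf. l.857–860 and Main Theorem item 1 "for sufficiently large M(Λ|Λˢᵗ)"] … there exists a C¹ embedding
ηˢ = (ηˢᵗ, ηʷᵏ) : (𝕋ˡ × Bˡ) × (𝕋^{d−m} × ℝ^{d−m}) → (𝕋ᵐ × Bᵐ) × (𝕋^{d−m} × ℝ^{d−m}), such that Λˢ = ηˢ(…) is a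
2(l+d−m)-dimensional NHWIC under Xˢ_Lag. Moreover, we have ‖ηˢᵗ − χˢᵗ‖_{C⁰} < δ, and any Xˢ_Lag-invariant set
contained in V × (𝕋^{d−m} × ℝ^{d−m}) is contained in Λˢ." (`Λ₀ˢᵗ = χˢᵗ(𝕋ˡ × Bˡ₁)`; `η` is typed on the whole cover
with the conclusions on `𝕋ˡ × Bˡ₁ × (cover of the weak factor)`.) [cite: KaloshinZhang2018, Theorem 2.3 l.862–886] -/
def Theorem23Shape {l : ℕ} {Tup USt : Type} (κ q : ℝ) (𝔖 : DominantData n m w Tup USt)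
    (ℭ : CylinderData n m w l Tup USt) (p₀ : Fin n → ℝ) (Ust : USt) : Prop :=
  ℭ.StrongNHIC p₀ Ust →
    ∃ V : Set ((Fin m → ℝ) × (Fin m → ℝ)), IsOpen V ∧ ℭ.χst '' cylDom l 1 ⊆ V ∧
      ∀ δ : ℝ, 0 < δ → ∃ M : ℝ, 0 < M ∧ ∀ t : Tup, (𝔖.pt t).p₀ = p₀ → 𝔖.ust t = Ust →
        (𝔖.pt t).InOmega κ q → M ≤ ((𝔖.pt t).minWeakN : ℝ) →
          ∃ η : ((Fin l → ℝ) × EuclideanSpace ℝ (Fin l)) × ((Fin w → ℝ) × (Fin w → ℝ)) → PhaseSp m w,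
            ContDiff ℝ 1 η ∧ Injective η ∧ (∀ x, Injective (fderiv ℝ η x)) ∧
              ℭ.IsNHWIC t (η '' (cylDom l 1 ×ˢ univ)) ∧
              (∃ δ' < δ, ∀ x ∈ cylDom l 1, ∀ y : (Fin w → ℝ) × (Fin w → ℝ), dist (η (x, y)).1 (ℭ.χst x) ≤ δ') ∧
              ∀ S : Set (PhaseSp m w), ℭ.IsInvariant t S → S ⊆ V ×ˢ univ → S ⊆ η '' (cylDom l 1 ×ˢ univ)

/-! ### Theorem 2.4 (semi-continuity of weak KAM solutions) as a shape -/

/-- SCHEMATIC weak KAM predicates for Theorem 2.4 (the notions of §2.6 / §6 are not built): "`u : 𝕋ᵈ → ℝ`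
(lifted to `ℝᵐ × ℝʷ`) is a weak KAM solution of `L_{𝓗ˢ(t)} − c·v`, `c = (cˢᵗ, cʷᵏ)`" and "`uˢᵗ : 𝕋ᵐ → ℝ` is a weak
KAM solution of `L_{𝓗ˢᵗ(p₀,U₀ˢᵗ)} − c̄·vˢᵗ`". [cite: KaloshinZhang2018, Theorem 2.4 l.983–986, l.1001–1004] -/
structure WeakKAMData (n m w : ℕ) (Tup USt : Type) where
  /-- weak KAM solutions of the dominant system of the tuple at cohomology `c = (cˢᵗ, cʷᵏ)` -/
  IsWeakKAM : Tup → (Fin m → ℝ) × (Fin w → ℝ) → ((Fin m → ℝ) × (Fin w → ℝ) → ℝ) → Prop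
  /-- weak KAM solutions of the strong system `𝓗ˢᵗ(p₀, Uˢᵗ)` at cohomology `c̄` -/
  IsWeakKAMst : (Fin n → ℝ) → USt → (Fin m → ℝ) → ((Fin m → ℝ) → ℝ) → Prop

/-- **Shape of Theorem 2.4** (thm:semi-cont, l.975–1005) for fixed `𝓑ˢᵗ`, `κ > 1`, `q > 2(d−m)`: for every
`p₀, U₀ˢᵗ, c̄` and every sequence of tuples `tᵢ ∈ Ω^{m,d}_{κ,q}(𝓑ˢᵗ)`, cohomologies `cᵢ = (cᵢˢᵗ, cᵢʷᵏ)` and weak KAM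
solutions `uᵢ` of `L_{𝓗ˢ(tᵢ)} − cᵢ·v` with "𝔐(𝓑ᵢʷᵏ) → ∞, pᵢ → p₀, Uᵢˢᵗ → U₀ˢᵗ" and "cᵢˢᵗ + Aᵢ⁻¹Bᵢcᵢʷᵏ → c̄" — the
latter CONCRETE: `BlockForm.cbar Aᵢ Bᵢ cᵢˢᵗ cᵢʷᵏ → c̄` with `Aᵢ = hessK Q(pᵢ) 𝓑ˢᵗ`, `Bᵢ = blockB Q(pᵢ) 𝓑ˢᵗ 𝓑ᵢʷᵏ` —:
"1. The sequence {uᵢ} is equi-continuous. … 2. Let u be any accumulation point of the sequence uᵢ(·) − uᵢ(0)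
[uniform limit of a subsequence of the lifts]. Then there exists uˢᵗ : 𝕋ᵐ → ℝ such that u(φˢᵗ, φʷᵏ) = uˢᵗ(φˢᵗ)
… 3. uˢᵗ is a weak KAM solution of L_{𝓗ˢᵗ(p₀,U₀ˢᵗ)} − c̄·vˢᵗ." (The "in particular, pre-compact in C⁰" of item 1
is Arzelà–Ascoli on `𝕋ᵈ` and is not restated.) [cite: KaloshinZhang2018, Theorem 2.4 l.975–1005] -/
def Theorem24Shape {Tup USt : Type} [TopologicalSpace USt] (κ q : ℝ) (𝔖 : DominantData n m w Tup USt)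
    (𝔚 : WeakKAMData n m w Tup USt) : Prop :=
  ∀ (p₀ : Fin n → ℝ) (Ust₀ : USt) (cbar : Fin m → ℝ) (t : ℕ → Tup) (c : ℕ → (Fin m → ℝ) × (Fin w → ℝ))
    (u : ℕ → (Fin m → ℝ) × (Fin w → ℝ) → ℝ),
    (∀ i, (𝔖.pt (t i)).InOmega κ q) →
    (∀ i, 𝔚.IsWeakKAM (t i) (c i) (u i)) →
    Tendsto (fun i => (𝔖.pt (t i)).minWeakN) atTop atTop →
    Tendsto (fun i => (𝔖.pt (t i)).p₀) atTop (𝓝 p₀) →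
    Tendsto (fun i => 𝔖.ust (t i)) atTop (𝓝 Ust₀) →
    Tendsto (fun i => BlockForm.cbar (𝔖.blkA (t i)) (𝔖.blkB (t i)) (c i).1 (c i).2) atTop (𝓝 cbar) →
      Equicontinuous u ∧
        ∀ v : (Fin m → ℝ) × (Fin w → ℝ) → ℝ,
          (∃ φ : ℕ → ℕ, StrictMono φ ∧ TendstoUniformly (fun i x => u (φ i) x - u (φ i) 0) v atTop) →
            ∃ vst : (Fin m → ℝ) → ℝ, (∀ x, v x = vst x.1) ∧ 𝔚.IsWeakKAMst p₀ Ust₀ cbar vst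

/-! ### The threshold bookkeeping of the Remark after Theorem 2.4 -/

/-- **Remark (l.1008–1012)**: with `q = r − n − 2(d−m) − 4` from Theorem 2.1, Theorem 2.4's `q > 2(d−m)` is
EXACTLY the Main Theorem's `r > n + 4(d−m) + 4` (l.445). [cite: KaloshinZhang2018, Remark l.1008–1012, Main Theorem l.445] -/
theorem threshold_main_iff (r n w : ℕ) :
    (2 * (w : ℝ) < (r : ℝ) - n - 2 * w - 4) ↔ n + 4 * w + 4 < r := by
  constructor
  · intro h
    have h' : ((n + 4 * w + 4 : ℕ) : ℝ) < (r : ℝ) := by push_cast; linarith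
    exact_mod_cast h'
  · intro h
    have h' : ((n + 4 * w + 4 : ℕ) : ℝ) < (r : ℝ) := by exact_mod_cast h
    push_cast at h'
    linarith

/-- … and it implies Theorems 2.2/2.3's `q > 2` as soon as `d − m ≥ 1` (l.1010–1011). [cite: KaloshinZhang2018, Remark l.1008–1012] -/
theorem threshold_resc_of_main {r n w : ℕ} (hw : 1 ≤ w) (h : n + 4 * w + 4 < r) :
    2 < (r : ℝ) - n - 2 * w - 4 := by
  have h' : ((n + 4 * w + 4 : ℕ) : ℝ) < (r : ℝ) := by exact_mod_cast h
  have hw' : (1 : ℝ) ≤ w := by exact_mod_cast hw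
  push_cast at h'
  linarith

/-- Theorem 2.1's exponent is positive exactly under its hypothesis `r > n + 2(d−m) + 4` (l.603–604, l.611).
[cite: KaloshinZhang2018, Theorem 2.1 l.603–611] -/
theorem threshold_basis_iff (r n w : ℕ) : (0 < (r : ℝ) - n - 2 * w - 4) ↔ n + 2 * w + 4 < r := by
  constructor
  · intro h
    have h' : ((n + 2 * w + 4 : ℕ) : ℝ) < (r : ℝ) := by push_cast; linarith
    exact_mod_cast h'
  · intro h
    have h' : ((n + 2 * w + 4 : ℕ) : ℝ) < (r : ℝ) := by exact_mod_cast h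
    push_cast at h'
    linarith

end Literature.Dynamics.Hamiltonian.KaloshinZhang2018
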